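import Summits.HodgeConjecture.HodgeConjecture.Theorems.R90S6TorusFixedSpecialCountTwoCongruentIntrinsic   -- ★ T2 `natCard_fixedBy_special_eq_one_add_mul_of_charpoly_two_congruent` (a₁ = 1 + q·m, intrinsic letters)
import Literature.NumberTheory.Automorphic.UnitaryGroupRankOneBigCell                                    -- ★ `UnitaryGroup.mem_glInt_iff_forall_v_le_one` (`K₀ = U ∩ GL₃(𝒪)` by entries)
import Literature.NumberTheory.Automorphic.FixedCosetsStableLattices                                     -- ★ `mem_fixedBy_quotient_mk_iff` (`gK ∈ Fix_γ ↔ g⁻¹γg ∈ K`)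
import HarnessLib

/-!
# R90 · S6 — LINE S1 «special fixed counts per regime», REGIME R-II, CARD R2M: THE CLOSED FORM OF `m` —
# `m(γ) = #Fix_Y(U ⧸ K₀)` FOR ANY UNIT `Y` OF THE SHIFTED ORDER `𝒪[γ, ϖ⁻¹(γ − c₁)(γ − c₂)]`, HENCE `a₁(γ) = 1 + q · #Fix_Y(U ⧸ K₀)`
# (`Theorems/R90S6TorusFixedSpecialCountTwoCongruentClosed.lean`)

Cell `hodgecm-mathlib`, crux H413 (`stmt-HodgeConjecture-24833`), route of record `HCCMUnconditional`; programme R90-TF, section S6 (base `R90-C14`), seat R90-C14-p05 (g2,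
heir of g0); S6 dealer R90-C14-plan (g2) card R2M «R-II CLOSED FORM OF m» (R90 bus 2026-09-05T02:23:40Z), census + heads 02:4xZ.  Helper lane
`--supports stmt-HodgeConjecture-24833 --as helper`; THEOREMS ONLY (no definition, no instance, no notation, no named fact, no `sorry`); imports = ★ T2 +
★ `UnitaryGroupRankOneBigCell` + ★ `FixedCosetsStableLattices` + HarnessLib.

THE MATHEMATICS [Kottwitz1986BaseChangeUnits, §1 pp. 240–241 and §3; Serre1980Trees, II §1.1; Rogawski1990, §4.9 Prop. 4.9.1 (b) p. 55].  `K` valued (`Valued K ℤᵐ⁰` + the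
compatible `ValuativeRel`), uniformiser `ϖ`, `U = U(σ, J₀)(K)`, `K₀ = U ∩ GL₃(𝒪) = (glInt 3 K).subgroupOf U`, `K₁` the special stabiliser (`g₁ = diag(1,1,ϖ)`), `γ ∈ U`.
★ T2 proved, for `χ_γ ≡ (X − c₁)²(X − c₂) (mod 𝔪)` with `|c₁| = |c₁ − c₂| = 1`, `σ(cᵢ)cᵢ ≡ 1`: **`a₁(γ) := #Fix_γ(U ⧸ K₁) = 1 + q·m(γ)`**, where
`m(γ) = #{x ∈ Fix_γ(U ⧸ K₀) : (k_x − c₁)(k_x − c₂) ≡ 0 (mod 𝔪)}`, `k_x = r(x)⁻¹ γ r(x)` (section `r`).  THIS FILE closes the letter `m`: a coset `x = gK₀` is counted by `m`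
iff `g⁻¹γg` AND `g⁻¹X₂g` are integral, `X₂ := ϖ⁻¹(γ − c₁)(γ − c₂)` — i.e. iff the lattice `g𝒪³` is stable under the SHIFTED ORDER `𝒪[γ, X₂]` — and the matrices `B` with `g⁻¹Bg`
integral form an `𝒪`-subalgebra (§1), so for every `Y ∈ U` generating the same order (`Y ∈ 𝒪[γ, X₂]`, `γ, X₂ ∈ 𝒪[Y]`): `x` is counted iff `g⁻¹Yg ∈ GL₃(𝒪)` iff `x ∈ Fix_Y(U ⧸ K₀)`
(§2, a unitary integral matrix lies in `GL₃(𝒪)`), whence **`m(γ) = #Fix_Y(U ⧸ K₀)`** (§3) and **`a₁(γ) = 1 + q · #Fix_Y(U ⧸ K₀)`** (§4 = ★ T2 ∘ §3); §5: `Fix_Y ⊆ Fix_γ` (the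
finiteness binder of the ★ a₀-engines at `Y`).  For the split (`E¹`-type) torus with eigenvalues `α₁ ≡ α₂` of depth `n₁₂ = v(α₁ − α₂) ≥ 1` and `α₃` separated, `𝒪[γ] = R_{n₁₂} × 𝒪`
and `𝒪[γ, X₂] = R_{n₁₂−1} × 𝒪` in the eigenframe (`R_k = {(x, y) : x ≡ y (ϖ^k)}`), so `Y` may be taken to be the Möbius∕Cayley shift `φ_ϖ(α₁⁻¹γ)` (depth `n₁₂ − 1`) and
`#Fix_Y` is a ★ Literature unit count ONE LEVEL DOWN (`phiZero`∕`phiOne` at `(n₁₂ − 1, 0, 0)`; the per-literal values are the sequel file `…TwoCongruentFlicker`): geometrically `Fix_γ`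
is the ball of radius `n₁₂` about the fixed point of the torus in the `U(1,1)`-tree of the `(α₁, α₂)`-plane and `m` counts its hyperspecial vertices of radius `≤ n₁₂ − 1`.
HONEST LABEL: a dictionary (§1–§3, §5) and a composition (§4 = ★ T2 ∘ §3), unconditional in their letters; count-neutral until the per-literal values and the E1.3.5.2 assembly
consume them; proves no printed statement.  HC_CM is proved only modulo the 7 printed citations (2 remaining named inputs: hLiu418 = stmt-HodgeConjecture-24832,
h413 = stmt-HodgeConjecture-24833) until rung 0 closes.

## References
* [Kottwitz1986BaseChangeUnits] R. E. Kottwitz, *Base change for unit elements of Hecke algebras*, Compositio Math. 60 (1986) 237–250, §1 pp. 240–241, §3.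
* [Serre1980Trees] J.-P. Serre, *Trees*, Springer (1980), Ch. II §1.1 (lattices, `GL_N(K) ⧸ GL_N(𝒪)`, stabilisers).
* [Rogawski1990] J. D. Rogawski, *Automorphic Representations of Unitary Groups in Three Variables*, Ann. of Math. Stud. 123 (1990), §4.9 Prop. 4.9.1 (b) p. 55.
-/

set_option autoImplicit false
-- the mandated namespace repeats the single-problem summit's segment (`HodgeConjecture.HodgeConjecture`)
set_option linter.dupNamespace false

noncomputable section

open MulAction
open Literature.NumberTheory.Automorphic Literature.NumberTheory.Automorphic.HermitianLattice Literature.NumberTheory.Automorphic.UnitaryGroup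
open scoped Matrix MatrixGroups WithZero Valued

namespace Summit.HodgeConjecture.HodgeConjecture.R90.S6

variable {K : Type*} [Field K] [Valued K ℤᵐ⁰]

/-! ### §1 The matrices `B` with `g⁻¹ B g` integral form an `𝒪`-subalgebra -/

/-- **The integrality locus of a frame is an `𝒪`-subalgebra.**  For `g ∈ GL₃(K)` and a set `s` of matrices `B` with `g⁻¹Bg` integral, every element `Y` of the
`𝒪`-algebra `𝒪[s]` they generate has `g⁻¹Yg` integral (the matrices with `g⁻¹Bg ∈ M₃(𝒪)` form an `𝒪`-subalgebra `g·M₃(𝒪)·g⁻¹` of `M₃(K)`; ★ (A) §4's argument for a set of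
generators). [cite: Kottwitz1986BaseChangeUnits, §3] [cite: Serre1980Trees, Ch. II §1.1] -/
theorem forall_v_conj_le_one_of_mem_adjoin (g : GL (Fin 3) K) {s : Set (Matrix (Fin 3) (Fin 3) K)}
    (hs : ∀ B ∈ s, ∀ i j, Valued.v (((((g⁻¹ : GL (Fin 3) K)) : Matrix (Fin 3) (Fin 3) K) * B * (g : Matrix (Fin 3) (Fin 3) K)) i j) ≤ 1)
    {Y : Matrix (Fin 3) (Fin 3) K} (hY : Y ∈ Algebra.adjoin 𝒪[K] s) :
    ∀ i j, Valued.v (((((g⁻¹ : GL (Fin 3) K)) : Matrix (Fin 3) (Fin 3) K) * Y * (g : Matrix (Fin 3) (Fin 3) K)) i j) ≤ 1 := by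
  set gM : Matrix (Fin 3) (Fin 3) K := (g : Matrix (Fin 3) (Fin 3) K) with hgM
  set gM' : Matrix (Fin 3) (Fin 3) K := (((g⁻¹ : GL (Fin 3) K)) : Matrix (Fin 3) (Fin 3) K) with hgM'
  have hgg : gM * gM' = 1 := by rw [hgM, hgM', ← Units.val_mul, mul_inv_cancel, Units.val_one]
  have hgg' : gM' * gM = 1 := by rw [hgM, hgM', ← Units.val_mul, inv_mul_cancel, Units.val_one]
  have hmul : ∀ A B : Matrix (Fin 3) (Fin 3) K, (∀ i j, Valued.v (A i j) ≤ 1) → (∀ i j, Valued.v (B i j) ≤ 1) → ∀ i j, Valued.v ((A * B) i j) ≤ 1 := by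
    intro A B hA hB i j
    rw [Matrix.mul_apply]
    refine Valuation.map_sum_le _ fun l _ => ?_
    rw [map_mul]; exact mul_le_one' (hA i l) (hB l j)
  let S : Subalgebra 𝒪[K] (Matrix (Fin 3) (Fin 3) K) :=
    { carrier := {B | ∀ i j, Valued.v ((gM' * B * gM) i j) ≤ 1}
      mul_mem' := by
        intro A B hA hB i j
        have e : gM' * (A * B) * gM = (gM' * A * gM) * (gM' * B * gM) := by
          calc gM' * (A * B) * gM = gM' * A * (gM * gM') * B * gM := by rw [hgg, Matrix.mul_one]; simp only [Matrix.mul_assoc]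
            _ = (gM' * A * gM) * (gM' * B * gM) := by simp only [Matrix.mul_assoc]
        show Valued.v ((gM' * (A * B) * gM) i j) ≤ 1
        rw [e]
        exact hmul _ _ hA hB i j
      one_mem' := by
        intro i j
        rw [Matrix.mul_one, hgg', Matrix.one_apply]
        split_ifs
        · rw [map_one]
        · rw [map_zero]; exact zero_le_one
      add_mem' := by
        intro A B hA hB i j
        rw [Matrix.mul_add, Matrix.add_mul, Matrix.add_apply]
        exact Valuation.map_add_le _ (hA i j) (hB i j)
      zero_mem' := by intro i j; rw [Matrix.mul_zero, Matrix.zero_mul, Matrix.zero_apply, map_zero]; exact zero_le_one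
      algebraMap_mem' := by
        intro a i j
        rw [Algebra.algebraMap_eq_smul_one, Matrix.mul_smul, Matrix.smul_mul, Matrix.mul_one, hgg', Matrix.smul_apply, Matrix.one_apply]
        split_ifs
        · rw [Subring.smul_def, smul_eq_mul, mul_one]; exact a.2
        · rw [smul_zero, map_zero]; exact zero_le_one }
  have hsS : s ⊆ (S : Set (Matrix (Fin 3) (Fin 3) K)) := fun B hB => hs B hB
  exact (Algebra.adjoin_le hsS : Algebra.adjoin 𝒪[K] s ≤ S) hY

/-- Entries in `𝔪` versus integrality after division by the uniformiser: `|(ϖ⁻¹M)_{ij}| ≤ 1 ∀ ⟺ |M_{ij}| < 1 ∀`. [cite: Serre1980Trees, Ch. II §1.1] -/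
theorem forall_v_inv_smul_le_one_iff {ϖ : K} (hϖ : Valued.v ϖ = WithZero.exp (-1 : ℤ)) (M : Matrix (Fin 3) (Fin 3) K) :
    (∀ i j, Valued.v ((ϖ⁻¹ • M) i j) ≤ 1) ↔ ∀ i j, Valued.v (M i j) < 1 := by
  have hϖ0 : Valued.v ϖ ≠ 0 := by rw [hϖ]; exact WithZero.coe_ne_zero
  refine forall_congr' fun i => forall_congr' fun j => ?_
  rw [Matrix.smul_apply, smul_eq_mul, map_mul, map_inv₀, ← div_eq_inv_mul, div_le_one₀ (zero_lt_iff.2 hϖ0), v_lt_one_iff, hϖ]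

/-! ### §2 The pointwise dictionary at a coset representative `g` -/

/-- **POINTWISE DICTIONARY.**  For `γ, Y, g ∈ U(σ, J₀)(K)` (`σ` isometric), scalars `c₁, c₂`, `X₂ = ϖ⁻¹(γ − c₁)(γ − c₂)`, and the shifted-order memberships
`Y ∈ 𝒪[γ, X₂]`, `γ ∈ 𝒪[Y]`, `X₂ ∈ 𝒪[Y]`: **`g⁻¹γg ∈ GL₃(𝒪) ∧ (g⁻¹γg − c₁)(g⁻¹γg − c₂) ≡ 0 (mod 𝔪) ⟺ g⁻¹Yg ∈ GL₃(𝒪)`** — both sides say that `γ`, `X₂`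
(resp. `Y`) lie in the `𝒪`-subalgebra of §1 at `g` (`g⁻¹(γ − c₁)(γ − c₂)g = (g⁻¹γg − c₁)(g⁻¹γg − c₂)`; a unitary integral matrix lies in `GL₃(𝒪)`, ★ `mem_glInt_iff_forall_v_le_one`).
[cite: Kottwitz1986BaseChangeUnits, §1 pp. 240–241, §3] [cite: Serre1980Trees, Ch. II §1.1] -/
theorem inv_mul_mul_mem_glInt_and_iff_of_mem_adjoin [ValuativeRel K] [(Valued.v : Valuation K ℤᵐ⁰).Compatible]
    {σ : K →+* K} (hvσ : ∀ a, Valued.v (σ a) = Valued.v a) {ϖ : K} (hϖ : Valued.v ϖ = WithZero.exp (-1 : ℤ))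
    (γ Y g : ↥(unitaryGroupOfForm σ ((StdForm.antidiagonal 3).over K))) (c₁ c₂ : K)
    (hY : ((Y : GL (Fin 3) K) : Matrix (Fin 3) (Fin 3) K) ∈ Algebra.adjoin 𝒪[K]
      ({((γ : GL (Fin 3) K) : Matrix (Fin 3) (Fin 3) K),
        ϖ⁻¹ • ((((γ : GL (Fin 3) K) : Matrix (Fin 3) (Fin 3) K) - c₁ • (1 : Matrix (Fin 3) (Fin 3) K)) *
          (((γ : GL (Fin 3) K) : Matrix (Fin 3) (Fin 3) K) - c₂ • (1 : Matrix (Fin 3) (Fin 3) K)))} : Set (Matrix (Fin 3) (Fin 3) K)))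
    (hγY : ((γ : GL (Fin 3) K) : Matrix (Fin 3) (Fin 3) K) ∈ Algebra.adjoin 𝒪[K] ({((Y : GL (Fin 3) K) : Matrix (Fin 3) (Fin 3) K)} : Set (Matrix (Fin 3) (Fin 3) K)))
    (hXY : ϖ⁻¹ • ((((γ : GL (Fin 3) K) : Matrix (Fin 3) (Fin 3) K) - c₁ • (1 : Matrix (Fin 3) (Fin 3) K)) *
        (((γ : GL (Fin 3) K) : Matrix (Fin 3) (Fin 3) K) - c₂ • (1 : Matrix (Fin 3) (Fin 3) K))) ∈
      Algebra.adjoin 𝒪[K] ({((Y : GL (Fin 3) K) : Matrix (Fin 3) (Fin 3) K)} : Set (Matrix (Fin 3) (Fin 3) K))) :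
    (((g⁻¹ * γ * g : ↥(unitaryGroupOfForm σ ((StdForm.antidiagonal 3).over K))) : GL (Fin 3) K) ∈ glInt 3 K ∧
        ∀ i j, Valued.v ((((((g⁻¹ * γ * g : ↥(unitaryGroupOfForm σ ((StdForm.antidiagonal 3).over K))) : GL (Fin 3) K) : Matrix (Fin 3) (Fin 3) K) -
              c₁ • (1 : Matrix (Fin 3) (Fin 3) K)) *
            ((((g⁻¹ * γ * g : ↥(unitaryGroupOfForm σ ((StdForm.antidiagonal 3).over K))) : GL (Fin 3) K) : Matrix (Fin 3) (Fin 3) K) -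
              c₂ • (1 : Matrix (Fin 3) (Fin 3) K))) i j) < 1) ↔
      ((g⁻¹ * Y * g : ↥(unitaryGroupOfForm σ ((StdForm.antidiagonal 3).over K))) : GL (Fin 3) K) ∈ glInt 3 K := by
  -- names
  set γM : Matrix (Fin 3) (Fin 3) K := ((γ : GL (Fin 3) K) : Matrix (Fin 3) (Fin 3) K) with hγM
  set YM : Matrix (Fin 3) (Fin 3) K := ((Y : GL (Fin 3) K) : Matrix (Fin 3) (Fin 3) K) with hYM
  set gM : Matrix (Fin 3) (Fin 3) K := (((g : ↥(unitaryGroupOfForm σ ((StdForm.antidiagonal 3).over K))) : GL (Fin 3) K) : Matrix (Fin 3) (Fin 3) K) with hgM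
  set gM' : Matrix (Fin 3) (Fin 3) K := (((((g : ↥(unitaryGroupOfForm σ ((StdForm.antidiagonal 3).over K))) : GL (Fin 3) K))⁻¹ : GL (Fin 3) K) : Matrix (Fin 3) (Fin 3) K)
    with hgM'
  set N : Matrix (Fin 3) (Fin 3) K := (γM - c₁ • (1 : Matrix (Fin 3) (Fin 3) K)) * (γM - c₂ • (1 : Matrix (Fin 3) (Fin 3) K)) with hN
  have hgg : gM * gM' = 1 := by rw [hgM, hgM', ← Units.val_mul, mul_inv_cancel, Units.val_one]
  have hgg' : gM' * gM = 1 := by rw [hgM, hgM', ← Units.val_mul, inv_mul_cancel, Units.val_one]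
  -- the conjugates as matrices
  have hconjγ : (((g⁻¹ * γ * g : ↥(unitaryGroupOfForm σ ((StdForm.antidiagonal 3).over K))) : GL (Fin 3) K) : Matrix (Fin 3) (Fin 3) K) = gM' * γM * gM := by
    rw [hgM', hgM, hγM, Subgroup.coe_mul, Subgroup.coe_mul, Subgroup.coe_inv, Units.val_mul, Units.val_mul]
  have hconjY : (((g⁻¹ * Y * g : ↥(unitaryGroupOfForm σ ((StdForm.antidiagonal 3).over K))) : GL (Fin 3) K) : Matrix (Fin 3) (Fin 3) K) = gM' * YM * gM := by
    rw [hgM', hgM, hYM, Subgroup.coe_mul, Subgroup.coe_mul, Subgroup.coe_inv, Units.val_mul, Units.val_mul]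
  have hsub : ∀ c : K, gM' * γM * gM - c • (1 : Matrix (Fin 3) (Fin 3) K) = gM' * (γM - c • (1 : Matrix (Fin 3) (Fin 3) K)) * gM := by
    intro c
    rw [Matrix.mul_sub, Matrix.sub_mul, Matrix.mul_smul, Matrix.smul_mul, Matrix.mul_one, hgg']
  have hprod : (gM' * γM * gM - c₁ • (1 : Matrix (Fin 3) (Fin 3) K)) * (gM' * γM * gM - c₂ • (1 : Matrix (Fin 3) (Fin 3) K)) = gM' * N * gM := by
    rw [hsub, hsub, hN]
    calc gM' * (γM - c₁ • (1 : Matrix (Fin 3) (Fin 3) K)) * gM * (gM' * (γM - c₂ • (1 : Matrix (Fin 3) (Fin 3) K)) * gM)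
        = gM' * (γM - c₁ • (1 : Matrix (Fin 3) (Fin 3) K)) * (gM * gM') * (γM - c₂ • (1 : Matrix (Fin 3) (Fin 3) K)) * gM := by
          simp only [Matrix.mul_assoc]
      _ = gM' * ((γM - c₁ • (1 : Matrix (Fin 3) (Fin 3) K)) * (γM - c₂ • (1 : Matrix (Fin 3) (Fin 3) K))) * gM := by
          rw [hgg, Matrix.mul_one]; simp only [Matrix.mul_assoc]
  have hX₂ : gM' * (ϖ⁻¹ • N) * gM = ϖ⁻¹ • (gM' * N * gM) := by rw [Matrix.mul_smul, Matrix.smul_mul]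
  -- the predicate ↔ `g⁻¹ X₂ g` integral
  have hpred : (∀ i j, Valued.v (((gM' * γM * gM - c₁ • (1 : Matrix (Fin 3) (Fin 3) K)) * (gM' * γM * gM - c₂ • (1 : Matrix (Fin 3) (Fin 3) K))) i j) < 1) ↔
      ∀ i j, Valued.v ((gM' * (ϖ⁻¹ • N) * gM) i j) ≤ 1 := by
    rw [hprod, hX₂, forall_v_inv_smul_le_one_iff hϖ]
  rw [UnitaryGroup.mem_glInt_iff_forall_v_le_one σ rfl hvσ (g⁻¹ * γ * g), UnitaryGroup.mem_glInt_iff_forall_v_le_one σ rfl hvσ (g⁻¹ * Y * g), hconjγ, hconjY,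
    hpred]
  constructor
  · rintro ⟨hγint, hXint⟩
    refine forall_v_conj_le_one_of_mem_adjoin ((g : ↥(unitaryGroupOfForm σ ((StdForm.antidiagonal 3).over K))) : GL (Fin 3) K) (s := {γM, ϖ⁻¹ • N}) ?_ hY
    intro B hB
    rcases hB with rfl | hB
    · exact hγint
    · rw [Set.mem_singleton_iff] at hB
      rw [hB]
      exact hXint
  · intro hYint
    have hs : ∀ B ∈ ({YM} : Set (Matrix (Fin 3) (Fin 3) K)), ∀ i j, Valued.v ((gM' * B * gM) i j) ≤ 1 := by
      intro B hB
      rw [Set.mem_singleton_iff] at hB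
      rw [hB]
      exact hYint
    exact ⟨forall_v_conj_le_one_of_mem_adjoin _ hs hγY, forall_v_conj_le_one_of_mem_adjoin _ hs hXY⟩

/-! ### §3 The count: `m(γ) = #Fix_Y(U ⧸ K₀)` -/

set_option synthInstance.maxHeartbeats 400000 in
-- the subgroup-quotient carrier `U ⧸ K₀` of ★ FILE 1 ∕ ★ T2 is slow to elaborate (same budget as ★ T2)
/-- **R2M (1) — THE RESIDUAL-MULTIPLICITY LETTER `m` OF ★ T2 IS A FIXED-POINT COUNT: `m(γ) = #Fix_Y(U ⧸ K₀)`.**  For `γ ∈ U(σ, J₀)(K)` (`σ` isometric, uniformiser `ϖ`),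
a section `r` of `U → U ⧸ K₀`, scalars `c₁, c₂`, and ANY `Y ∈ U` with `Y ∈ 𝒪[γ, X₂]`, `γ ∈ 𝒪[Y]`, `X₂ ∈ 𝒪[Y]` (`X₂ = ϖ⁻¹(γ − c₁)(γ − c₂)`, `𝒪 = Valued.integer K`):
`#{x ∈ Fix_γ(U ⧸ K₀) : (k_x − c₁)(k_x − c₂) ≡ 0 (mod 𝔪)} = #Fix_Y(U ⧸ K₀)`, `k_x = r(x)⁻¹ γ r(x)` — the subtype of ★ T2's head VERBATIM on the left.  §2 at `g = r(x)`.
[cite: Kottwitz1986BaseChangeUnits, §1 pp. 240–241, §3] [cite: Serre1980Trees, Ch. II §1.1] [cite: Rogawski1990, §4.9 Prop. 4.9.1 (b) p. 55] -/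
theorem natCard_twoCongruent_eq_natCard_fixedBy_of_mem_adjoin [ValuativeRel K] [(Valued.v : Valuation K ℤᵐ⁰).Compatible]
    {σ : K →+* K} (hvσ : ∀ a, Valued.v (σ a) = Valued.v a) {ϖ : K} (hϖ : Valued.v ϖ = WithZero.exp (-1 : ℤ))
    (γ : ↥(unitaryGroupOfForm σ ((StdForm.antidiagonal 3).over K)))
    (r : ↥(unitaryGroupOfForm σ ((StdForm.antidiagonal 3).over K)) ⧸ (glInt 3 K).subgroupOf (unitaryGroupOfForm σ ((StdForm.antidiagonal 3).over K)) →
      ↥(unitaryGroupOfForm σ ((StdForm.antidiagonal 3).over K)))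
    (hr : Function.RightInverse r QuotientGroup.mk) {c₁ c₂ : K}
    (Y : ↥(unitaryGroupOfForm σ ((StdForm.antidiagonal 3).over K)))
    (hY : ((Y : GL (Fin 3) K) : Matrix (Fin 3) (Fin 3) K) ∈ Algebra.adjoin 𝒪[K]
      ({((γ : GL (Fin 3) K) : Matrix (Fin 3) (Fin 3) K),
        ϖ⁻¹ • ((((γ : GL (Fin 3) K) : Matrix (Fin 3) (Fin 3) K) - c₁ • (1 : Matrix (Fin 3) (Fin 3) K)) *
          (((γ : GL (Fin 3) K) : Matrix (Fin 3) (Fin 3) K) - c₂ • (1 : Matrix (Fin 3) (Fin 3) K)))} : Set (Matrix (Fin 3) (Fin 3) K)))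
    (hγY : ((γ : GL (Fin 3) K) : Matrix (Fin 3) (Fin 3) K) ∈ Algebra.adjoin 𝒪[K] ({((Y : GL (Fin 3) K) : Matrix (Fin 3) (Fin 3) K)} : Set (Matrix (Fin 3) (Fin 3) K)))
    (hXY : ϖ⁻¹ • ((((γ : GL (Fin 3) K) : Matrix (Fin 3) (Fin 3) K) - c₁ • (1 : Matrix (Fin 3) (Fin 3) K)) *
        (((γ : GL (Fin 3) K) : Matrix (Fin 3) (Fin 3) K) - c₂ • (1 : Matrix (Fin 3) (Fin 3) K))) ∈
      Algebra.adjoin 𝒪[K] ({((Y : GL (Fin 3) K) : Matrix (Fin 3) (Fin 3) K)} : Set (Matrix (Fin 3) (Fin 3) K))) :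
    Nat.card {x : fixedBy (↥(unitaryGroupOfForm σ ((StdForm.antidiagonal 3).over K)) ⧸
          (glInt 3 K).subgroupOf (unitaryGroupOfForm σ ((StdForm.antidiagonal 3).over K))) γ //
        ∀ i j, Valued.v (((((((r x.1)⁻¹ * γ * r x.1 : ↥(unitaryGroupOfForm σ ((StdForm.antidiagonal 3).over K))) : GL (Fin 3) K) : Matrix (Fin 3) (Fin 3) K) -
            c₁ • (1 : Matrix (Fin 3) (Fin 3) K)) *
          (((((r x.1)⁻¹ * γ * r x.1 : ↥(unitaryGroupOfForm σ ((StdForm.antidiagonal 3).over K))) : GL (Fin 3) K) : Matrix (Fin 3) (Fin 3) K) -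
            c₂ • (1 : Matrix (Fin 3) (Fin 3) K))) i j) < 1} =
      Nat.card (fixedBy (↥(unitaryGroupOfForm σ ((StdForm.antidiagonal 3).over K)) ⧸
          (glInt 3 K).subgroupOf (unitaryGroupOfForm σ ((StdForm.antidiagonal 3).over K))) Y) := by
  -- membership in a fixed set, read on the representative `r q`
  have hmem : ∀ (Z : ↥(unitaryGroupOfForm σ ((StdForm.antidiagonal 3).over K)))
      (q : ↥(unitaryGroupOfForm σ ((StdForm.antidiagonal 3).over K)) ⧸ (glInt 3 K).subgroupOf (unitaryGroupOfForm σ ((StdForm.antidiagonal 3).over K))),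
      q ∈ fixedBy (↥(unitaryGroupOfForm σ ((StdForm.antidiagonal 3).over K)) ⧸
          (glInt 3 K).subgroupOf (unitaryGroupOfForm σ ((StdForm.antidiagonal 3).over K))) Z ↔
        (((r q)⁻¹ * Z * r q : ↥(unitaryGroupOfForm σ ((StdForm.antidiagonal 3).over K))) : GL (Fin 3) K) ∈ glInt 3 K := by
    intro Z q
    rw [← Subgroup.mem_subgroupOf (K := unitaryGroupOfForm σ ((StdForm.antidiagonal 3).over K)), ← mem_fixedBy_quotient_mk_iff, hr q]
  refine Nat.card_congr ((Equiv.subtypeSubtypeEquivSubtypeInter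
    (fun q => q ∈ fixedBy (↥(unitaryGroupOfForm σ ((StdForm.antidiagonal 3).over K)) ⧸
      (glInt 3 K).subgroupOf (unitaryGroupOfForm σ ((StdForm.antidiagonal 3).over K))) γ)
    (fun q => ∀ i j, Valued.v (((((((r q)⁻¹ * γ * r q : ↥(unitaryGroupOfForm σ ((StdForm.antidiagonal 3).over K))) : GL (Fin 3) K) : Matrix (Fin 3) (Fin 3) K) -
            c₁ • (1 : Matrix (Fin 3) (Fin 3) K)) *
          (((((r q)⁻¹ * γ * r q : ↥(unitaryGroupOfForm σ ((StdForm.antidiagonal 3).over K))) : GL (Fin 3) K) : Matrix (Fin 3) (Fin 3) K) -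
            c₂ • (1 : Matrix (Fin 3) (Fin 3) K))) i j) < 1)).trans (Equiv.subtypeEquivRight fun q => ?_))
  show (q ∈ fixedBy _ γ ∧ _) ↔ q ∈ fixedBy _ Y
  rw [hmem γ q, hmem Y q]
  exact inv_mul_mul_mem_glInt_and_iff_of_mem_adjoin hvσ hϖ γ Y (r q) c₁ c₂ hY hγY hXY

/-! ### §4 The head: `a₁(γ) = 1 + q · #Fix_Y(U ⧸ K₀)` (★ T2 ∘ §3) -/

-- the quotient-action instances `MulAction ↥K₀ (↥K₀ ⧸ I.subgroupOf K₀)` of ★ FILE 1 ∕ FILE 2 exceed the default synthesis budget (same bump as ★ T2)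
set_option synthInstance.maxHeartbeats 400000 in
set_option maxHeartbeats 1600000 in
/-- **R2M (2) — THE R-II CLOSED FORM: `a₁(γ) = 1 + q · #Fix_Y(U ⧸ K₀)`.**  In ★ T2's letters VERBATIM (`γ ∈ U(σ, J₀)(K)` with `χ_γ ≡ (X − c₁)²(X − c₂)` coefficientwise
mod `𝔪`, `|c₁| = |c₁ − c₂| = 1`, `σ(cᵢ)cᵢ ≡ 1`, residue field of order `q²`, `σ` reducing to the `q`-Frobenius, section `r`, the finiteness binders) and for ANY unit
`Y ∈ U` of the shifted order — `Y ∈ 𝒪[γ, X₂]`, `γ ∈ 𝒪[Y]`, `X₂ ∈ 𝒪[Y]`, `X₂ = ϖ⁻¹(γ − c₁)(γ − c₂)` — the number `a₁(γ) = #Fix_γ(U ⧸ K₁)` of `γ`-fixed special vertices is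
`1 + q · #Fix_Y(U ⧸ K₀)`: ★ T2 `a₁ = 1 + q·m` with `m = #Fix_Y(U ⧸ K₀)` by §3.  (For the split torus of depth `n₁₂`, `Y` = the Möbius shift of depth `n₁₂ − 1` and `#Fix_Y` is the
★ Literature unit count one level down.) [cite: Kottwitz1986BaseChangeUnits, §1 pp. 240–241, §3] [cite: Serre1980Trees, Ch. II §1.1] [cite: Rogawski1990, §4.9 Prop. 4.9.1 (b) p. 55] -/
theorem natCard_fixedBy_special_eq_one_add_mul_natCard_fixedBy_of_mem_adjoin [ValuativeRel K] [(Valued.v : Valuation K ℤᵐ⁰).Compatible]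
    {σ : K →+* K} {ϖ : K} (hd : UnramifiedLocalConjDatum σ ϖ) (hσO : ∀ x : 𝒪[K], σ x ∈ 𝒪[K]) (σk : 𝓀[K] →+* 𝓀[K])
    (hσk : ∀ x : 𝒪[K], IsLocalRing.residue 𝒪[K] ⟨σ x, hσO x⟩ = σk (IsLocalRing.residue 𝒪[K] x))
    [Fintype 𝓀[K]] {q : ℕ} (hq : Fintype.card 𝓀[K] = q ^ 2) (hfrob : ∀ y, σk y = y ^ q)
    (g₁ : GL (Fin 3) K) (hg₁ : (g₁ : Matrix (Fin 3) (Fin 3) K) = Matrix.diagonal ![(1 : K), 1, ϖ])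
    (γ : ↥(unitaryGroupOfForm σ ((StdForm.antidiagonal 3).over K)))
    [Fintype (fixedBy (↥(unitaryGroupOfForm σ ((StdForm.antidiagonal 3).over K)) ⧸
      (glInt 3 K).subgroupOf (unitaryGroupOfForm σ ((StdForm.antidiagonal 3).over K))) γ)]
    (hK₁fin : (fixedBy (↥(unitaryGroupOfForm σ ((StdForm.antidiagonal 3).over K)) ⧸
      ((glInt 3 K).map (MulAut.conj g₁).toMonoidHom).subgroupOf (unitaryGroupOfForm σ ((StdForm.antidiagonal 3).over K))) γ).Finite)
    (horb : (Set.range fun n : ℕ => ((γ ^ n : ↥(unitaryGroupOfForm σ ((StdForm.antidiagonal 3).over K))) :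
      ↥(unitaryGroupOfForm σ ((StdForm.antidiagonal 3).over K)) ⧸ (glInt 3 K).subgroupOf (unitaryGroupOfForm σ ((StdForm.antidiagonal 3).over K)))).Finite)
    (r : ↥(unitaryGroupOfForm σ ((StdForm.antidiagonal 3).over K)) ⧸ (glInt 3 K).subgroupOf (unitaryGroupOfForm σ ((StdForm.antidiagonal 3).over K)) →
      ↥(unitaryGroupOfForm σ ((StdForm.antidiagonal 3).over K)))
    (hr : Function.RightInverse r QuotientGroup.mk)
    [∀ x : fixedBy (↥(unitaryGroupOfForm σ ((StdForm.antidiagonal 3).over K)) ⧸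
        (glInt 3 K).subgroupOf (unitaryGroupOfForm σ ((StdForm.antidiagonal 3).over K))) γ,
      Finite (fixedBy (↥((glInt 3 K).subgroupOf (unitaryGroupOfForm σ ((StdForm.antidiagonal 3).over K))) ⧸
        (((glInt 3 K).subgroupOf (unitaryGroupOfForm σ ((StdForm.antidiagonal 3).over K)) ⊓
          ((glInt 3 K).map (MulAut.conj g₁).toMonoidHom).subgroupOf (unitaryGroupOfForm σ ((StdForm.antidiagonal 3).over K))).subgroupOf
          ((glInt 3 K).subgroupOf (unitaryGroupOfForm σ ((StdForm.antidiagonal 3).over K)))))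
        (⟨(r x.1)⁻¹ * γ * r x.1, inv_mul_mul_mem_of_smul_eq r hr γ x.2⟩ :
          ↥((glInt 3 K).subgroupOf (unitaryGroupOfForm σ ((StdForm.antidiagonal 3).over K)))))]
    {c₁ c₂ : K} (hc₁ : Valued.v c₁ = 1) (hsep : Valued.v (c₁ - c₂) = 1) (hu₁ : Valued.v (σ c₁ * c₁ - 1) < 1) (hu₂ : Valued.v (σ c₂ * c₂ - 1) < 1)
    (hχ : ∀ i, Valued.v (((((γ : ↥(unitaryGroupOfForm σ ((StdForm.antidiagonal 3).over K))) : GL (Fin 3) K) : Matrix (Fin 3) (Fin 3) K).charpoly -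
      (Polynomial.X - Polynomial.C c₁) ^ 2 * (Polynomial.X - Polynomial.C c₂)).coeff i) < 1)
    -- the unit `Y` of the shifted order `𝒪[γ, X₂]`
    (Y : ↥(unitaryGroupOfForm σ ((StdForm.antidiagonal 3).over K)))
    (hY : ((Y : GL (Fin 3) K) : Matrix (Fin 3) (Fin 3) K) ∈ Algebra.adjoin 𝒪[K]
      ({((γ : GL (Fin 3) K) : Matrix (Fin 3) (Fin 3) K),
        ϖ⁻¹ • ((((γ : GL (Fin 3) K) : Matrix (Fin 3) (Fin 3) K) - c₁ • (1 : Matrix (Fin 3) (Fin 3) K)) *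
          (((γ : GL (Fin 3) K) : Matrix (Fin 3) (Fin 3) K) - c₂ • (1 : Matrix (Fin 3) (Fin 3) K)))} : Set (Matrix (Fin 3) (Fin 3) K)))
    (hγY : ((γ : GL (Fin 3) K) : Matrix (Fin 3) (Fin 3) K) ∈ Algebra.adjoin 𝒪[K] ({((Y : GL (Fin 3) K) : Matrix (Fin 3) (Fin 3) K)} : Set (Matrix (Fin 3) (Fin 3) K)))
    (hXY : ϖ⁻¹ • ((((γ : GL (Fin 3) K) : Matrix (Fin 3) (Fin 3) K) - c₁ • (1 : Matrix (Fin 3) (Fin 3) K)) *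
        (((γ : GL (Fin 3) K) : Matrix (Fin 3) (Fin 3) K) - c₂ • (1 : Matrix (Fin 3) (Fin 3) K))) ∈
      Algebra.adjoin 𝒪[K] ({((Y : GL (Fin 3) K) : Matrix (Fin 3) (Fin 3) K)} : Set (Matrix (Fin 3) (Fin 3) K))) :
    Nat.card (fixedBy (↥(unitaryGroupOfForm σ ((StdForm.antidiagonal 3).over K)) ⧸
        ((glInt 3 K).map (MulAut.conj g₁).toMonoidHom).subgroupOf (unitaryGroupOfForm σ ((StdForm.antidiagonal 3).over K))) γ) =
      1 + q * Nat.card (fixedBy (↥(unitaryGroupOfForm σ ((StdForm.antidiagonal 3).over K)) ⧸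
          (glInt 3 K).subgroupOf (unitaryGroupOfForm σ ((StdForm.antidiagonal 3).over K))) Y) := by
  rw [natCard_fixedBy_special_eq_one_add_mul_of_charpoly_two_congruent hd hσO σk hσk hq hfrob g₁ hg₁ γ hK₁fin horb r hr hc₁ hsep hu₁ hu₂ hχ,
    natCard_twoCongruent_eq_natCard_fixedBy_of_mem_adjoin hd.vσ hd.vϖ γ r hr Y hY hγY hXY]

/-! ### §5 `Fix_Y ⊆ Fix_γ`: the fixed cosets of the shift are finite when those of `γ` are (the finiteness binder of the ★ a₀-engines at `Y`) -/

set_option synthInstance.maxHeartbeats 400000 in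
-- as above
/-- **`Fix_Y(U ⧸ K₀) ⊆ Fix_γ(U ⧸ K₀)`** for `Y ∈ U` with `γ ∈ 𝒪[Y]`: a coset `gK₀` with `g⁻¹Yg` integral has `g⁻¹γg` integral (§1), i.e. lies in `Fix_γ` (a unitary integral matrix lies in
`GL₃(𝒪)`). [cite: Kottwitz1986BaseChangeUnits, §1 pp. 240–241, §3] [cite: Serre1980Trees, Ch. II §1.1] -/
theorem fixedBy_subset_fixedBy_of_mem_adjoin_singleton [ValuativeRel K] [(Valued.v : Valuation K ℤᵐ⁰).Compatible]
    {σ : K →+* K} (hvσ : ∀ a, Valued.v (σ a) = Valued.v a)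
    (γ Y : ↥(unitaryGroupOfForm σ ((StdForm.antidiagonal 3).over K)))
    (hγY : ((γ : GL (Fin 3) K) : Matrix (Fin 3) (Fin 3) K) ∈ Algebra.adjoin 𝒪[K] ({((Y : GL (Fin 3) K) : Matrix (Fin 3) (Fin 3) K)} : Set (Matrix (Fin 3) (Fin 3) K))) :
    fixedBy (↥(unitaryGroupOfForm σ ((StdForm.antidiagonal 3).over K)) ⧸
        (glInt 3 K).subgroupOf (unitaryGroupOfForm σ ((StdForm.antidiagonal 3).over K))) Y ⊆
      fixedBy (↥(unitaryGroupOfForm σ ((StdForm.antidiagonal 3).over K)) ⧸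
        (glInt 3 K).subgroupOf (unitaryGroupOfForm σ ((StdForm.antidiagonal 3).over K))) γ := by
  intro q hq
  rw [← QuotientGroup.out_eq' q, mem_fixedBy_quotient_mk_iff, Subgroup.mem_subgroupOf] at hq ⊢
  rw [UnitaryGroup.mem_glInt_iff_forall_v_le_one σ rfl hvσ] at hq ⊢
  have e : ∀ Z : ↥(unitaryGroupOfForm σ ((StdForm.antidiagonal 3).over K)),
      (((q.out⁻¹ * Z * q.out : ↥(unitaryGroupOfForm σ ((StdForm.antidiagonal 3).over K))) : GL (Fin 3) K) : Matrix (Fin 3) (Fin 3) K) =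
        (((((q.out : ↥(unitaryGroupOfForm σ ((StdForm.antidiagonal 3).over K))) : GL (Fin 3) K))⁻¹ : GL (Fin 3) K) : Matrix (Fin 3) (Fin 3) K) *
          ((Z : GL (Fin 3) K) : Matrix (Fin 3) (Fin 3) K) * (((q.out : ↥(unitaryGroupOfForm σ ((StdForm.antidiagonal 3).over K))) : GL (Fin 3) K) : Matrix (Fin 3) (Fin 3) K) := by
    intro Z
    rw [Subgroup.coe_mul, Subgroup.coe_mul, Subgroup.coe_inv, Units.val_mul, Units.val_mul]
  rw [e] at hq ⊢
  refine forall_v_conj_le_one_of_mem_adjoin _ (s := {((Y : GL (Fin 3) K) : Matrix (Fin 3) (Fin 3) K)}) ?_ hγY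
  intro B hB
  rw [Set.mem_singleton_iff] at hB
  rw [hB]
  exact hq

set_option synthInstance.maxHeartbeats 400000 in
-- as above
/-- **`Fix_Y(U ⧸ K₀)` is finite when `Fix_γ(U ⧸ K₀)` is**, for `Y ∈ U` with `γ ∈ 𝒪[Y]` — the finiteness binder the ★ Literature unit counts (`…_eq_phiZero`, `…_eq_phiOne_of_bridge`)
need at the shift `Y`. [cite: Kottwitz1986BaseChangeUnits, §1 pp. 240–241] -/
theorem finite_fixedBy_of_mem_adjoin_singleton [ValuativeRel K] [(Valued.v : Valuation K ℤᵐ⁰).Compatible]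
    {σ : K →+* K} (hvσ : ∀ a, Valued.v (σ a) = Valued.v a)
    (γ Y : ↥(unitaryGroupOfForm σ ((StdForm.antidiagonal 3).over K)))
    (hγY : ((γ : GL (Fin 3) K) : Matrix (Fin 3) (Fin 3) K) ∈ Algebra.adjoin 𝒪[K] ({((Y : GL (Fin 3) K) : Matrix (Fin 3) (Fin 3) K)} : Set (Matrix (Fin 3) (Fin 3) K)))
    (hfin : (fixedBy (↥(unitaryGroupOfForm σ ((StdForm.antidiagonal 3).over K)) ⧸
        (glInt 3 K).subgroupOf (unitaryGroupOfForm σ ((StdForm.antidiagonal 3).over K))) γ).Finite) :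
    (fixedBy (↥(unitaryGroupOfForm σ ((StdForm.antidiagonal 3).over K)) ⧸
        (glInt 3 K).subgroupOf (unitaryGroupOfForm σ ((StdForm.antidiagonal 3).over K))) Y).Finite :=
  hfin.subset (fixedBy_subset_fixedBy_of_mem_adjoin_singleton hvσ γ Y hγY)

end Summit.HodgeConjecture.HodgeConjecture.R90.S6

end
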